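import Mathlib
import Summits.CriticalPhenomena.PercolationContinuityZ3.Theorems.PercNearOneGluingNoHeavyLowerTailOrientedAntipodalHallCyclicSDR

/-!
# LOC-P₂: capacity-two good representatives for all antipodal bads on three petals

Helper file for crux `stmt-CriticalPhenomena-4575` (`NoHeavyLowerTail`, route `PercNearOneGluingNoHeavy`),
new-inequality factory seat `prim-ineq-gen-3` (gen 9).  Everything here is PROVED.

For a monotone `Lab`-labeling and three distinct petals `i, j, l`, the antipodal bads of the six ordered types on
`{i, j, l}` split into the bads of the two CYCLIC selections `(i,j),(j,l),(l,i)` and `(j,i),(i,l),(l,j)`; each admits a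
system of distinct good representatives (`exists_injective_good_above_cyclic`, unconditional since gen 9), so all
antipodal bads admit good representatives with every good set used at most twice — the statement `LOC-P₂`
(capacity-2 Hall) of the LOC-COMB programme (memo `run/shared/lean/prim/prim-ineq-gen-3/COMB.md` §3c,
MS3-STATE.md §1; prim-ineq-gen-3 gen 9, 2026-08-20).
-/

namespace Summit.CriticalPhenomena.PercolationContinuityZ3.Theorems

namespace OrientedAntipodalHall

open Finset AntipodalStrongHarris AntipodalStrongHarris.Lab

variable {α : Type*} [DecidableEq α] {k : ℕ}

/-- **LOC-P₂ (capacity two), unconditional.**  Six families of antipodal bads of the six ordered types on three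
distinct petals `i, j, l` admit good representatives (`X ⊆ φ X ⊆ S`, `f (φ X) = top`, `f (S \ φ X) = bot`), injective
on the cyclic half `D_ij ∪ D_jl ∪ D_li` and injective on the reverse-cyclic half `D_ji ∪ D_il ∪ D_lj`; in particular
every good set represents at most two bads. -/
theorem exists_good_above_capacity_two (S : Finset α) {f : Finset α → Lab k}
    (hf : ∀ ⦃X Y : Finset α⦄, X ⊆ Y → f X ≤ f Y) (Dij Djl Dli Dji Dil Dlj : Finset (Finset α)) {i j l : Fin k}
    (hij : i ≠ j) (hjl : j ≠ l) (hil : i ≠ l)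
    (hijS : ∀ X ∈ Dij, X ⊆ S) (hij₁ : ∀ X ∈ Dij, f X = petal i) (hij₂ : ∀ X ∈ Dij, f (S \ X) = petal j)
    (hjlS : ∀ X ∈ Djl, X ⊆ S) (hjl₁ : ∀ X ∈ Djl, f X = petal j) (hjl₂ : ∀ X ∈ Djl, f (S \ X) = petal l)
    (hliS : ∀ X ∈ Dli, X ⊆ S) (hli₁ : ∀ X ∈ Dli, f X = petal l) (hli₂ : ∀ X ∈ Dli, f (S \ X) = petal i)
    (hjiS : ∀ X ∈ Dji, X ⊆ S) (hji₁ : ∀ X ∈ Dji, f X = petal j) (hji₂ : ∀ X ∈ Dji, f (S \ X) = petal i)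
    (hilS : ∀ X ∈ Dil, X ⊆ S) (hil₁ : ∀ X ∈ Dil, f X = petal i) (hil₂ : ∀ X ∈ Dil, f (S \ X) = petal l)
    (hljS : ∀ X ∈ Dlj, X ⊆ S) (hlj₁ : ∀ X ∈ Dlj, f X = petal l) (hlj₂ : ∀ X ∈ Dlj, f (S \ X) = petal j) :
    (∃ φ : ↥(Dij ∪ Djl ∪ Dli) → Finset α, Function.Injective φ ∧
      ∀ X : ↥(Dij ∪ Djl ∪ Dli), (X : Finset α) ⊆ φ X ∧ φ X ⊆ S ∧ f (φ X) = top ∧ f (S \ φ X) = bot) ∧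
    (∃ ψ : ↥(Dji ∪ Dil ∪ Dlj) → Finset α, Function.Injective ψ ∧
      ∀ X : ↥(Dji ∪ Dil ∪ Dlj), (X : Finset α) ⊆ ψ X ∧ ψ X ⊆ S ∧ f (ψ X) = top ∧ f (S \ ψ X) = bot) :=
  ⟨exists_injective_good_above_cyclic S hf Dij Djl Dli hij hjl hil hijS hij₁ hij₂ hjlS hjl₁ hjl₂ hliS hli₁ hli₂,
   exists_injective_good_above_cyclic S hf Dji Dil Dlj hij.symm hil hjl hjiS hji₁ hji₂ hilS hil₁ hil₂
     hljS hlj₁ hlj₂⟩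

end OrientedAntipodalHall

end Summit.CriticalPhenomena.PercolationContinuityZ3.Theorems
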